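import Summits.QuantumFields.YangMills.Theorems.CurvatureBoostCovariance.Negative.Unbundled
import Literature.MathematicalPhysics.QuantumFieldTheory.OSReconstructionNoE1

/-!
# Sketch — crux idea `transverse-slack-heat-sandwich`
crux stmt-QuantumFields-14999 `MirrorModularBoosts.SoftKernelBoostCovariance` (crux-ideate r1, ideator 2).

First lemmas of the line (all elaborate; (L1), (L2) proved):
* (L1) `cone_boost_lower_bound`  — on the planar cone `|p| ≤ E` the boosted energy `cosh χ·E + sinh χ·p` dominates
  `e^{-|χ|} E`: the scalar heart of `e^{-τ H_χ} ≤ e^{-τ e^{-|χ|} H}` (commuting functional calculus of `(H, P₁)`).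
* (L2) `boosted_energy_le`       — and is dominated by `e^{|χ|} E`: boosted lower-level vectors cost at most
  `e^{|χ|}` in energy (Löwner with exponent `≤ 1`).
* (L3) `laurent_neg_layers_vanish_of_growth` — sub-threshold growth `O(e^{cχ})`, `c < 8`, along the ray kills the
  layers `k ≤ -2` of a finite Laurent sum (pure analysis, M; `sorry`).
* (S)  `PlanarSandwichBound`     — the SMEARED SHADOW of the stub (the transversely filtered, heat-sandwiched
  curvature insertion has exponent `μ < 4`), typed over the tree's `OSReconstructionNoE1` vectors.
* (T)  `levelStep_of_sandwich`   — the shape of what the line feeds into the registered skeleton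
  `Cruxes/CurvatureBoostCovariance/Lines/boosts_inherit_mirrors.lean` in place of `stub_levelGrowthHigh`
  (statement only; `sorry`).
-/

noncomputable section

open scoped SchwartzMap BigOperators
open MeasureTheory Filter Topology
open Literature.MathematicalPhysics.AQFT Literature.MathematicalPhysics.QuantumLattice
open Literature.MathematicalPhysics.QuantumFieldTheory
open Summit.QuantumFields.YangMills.Theorems.CurvatureBoostCovariance.Negative

namespace Summit.QuantumFields.YangMills.Cruxes.SoftKernelBoostCovariance.TransverseSlackHeatSandwich

local notation "E4" => EuclideanSpace ℝ (Fin 4)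

/-! ## (L1)–(L2): the two scalar inequalities behind "boosts inherit contractions" -/

theorem cosh_sub_abs_sinh (χ : ℝ) : Real.cosh χ - |Real.sinh χ| = Real.exp (-|χ|) := by
  rcases le_or_gt 0 χ with h | h
  · rw [abs_of_nonneg (Real.sinh_nonneg_iff.mpr h), abs_of_nonneg h, Real.cosh_sub_sinh]
  · have hs : Real.sinh χ < 0 := Real.sinh_neg_iff.mpr h
    rw [abs_of_neg hs, abs_of_neg h, sub_neg_eq_add, neg_neg, Real.cosh_add_sinh]

theorem cosh_add_abs_sinh (χ : ℝ) : Real.cosh χ + |Real.sinh χ| = Real.exp |χ| := by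
  rcases le_or_gt 0 χ with h | h
  · rw [abs_of_nonneg (Real.sinh_nonneg_iff.mpr h), abs_of_nonneg h, Real.cosh_add_sinh]
  · have hs : Real.sinh χ < 0 := Real.sinh_neg_iff.mpr h
    rw [abs_of_neg hs, abs_of_neg h, ← sub_eq_add_neg, Real.cosh_sub_sinh]

/-- **(L1) Cone ⇒ boosted contraction.** For a joint spectral point `(E, p)` of `(H, P₁)` in the planar cone
`|p| ≤ E`, the boosted energy `H_χ = cosh χ·H + sinh χ·P₁` satisfies `H_χ ≥ e^{-|χ|} H` pointwise on the spectrum;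
by commuting functional calculus `‖e^{-τH_χ} v‖ ≤ ‖e^{-τ e^{-|χ|} H} v‖` for every vector `v` and `τ ≥ 0`. -/
theorem cone_boost_lower_bound (χ E p : ℝ) (hE : |p| ≤ E) :
    Real.exp (-|χ|) * E ≤ Real.cosh χ * E + Real.sinh χ * p := by
  have h1 : |Real.sinh χ * p| ≤ |Real.sinh χ| * E := by
    rw [abs_mul]; exact mul_le_mul_of_nonneg_left hE (abs_nonneg _)
  have h2 : -(|Real.sinh χ| * E) ≤ Real.sinh χ * p := by linarith [neg_abs_le (Real.sinh χ * p)]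
  calc Real.exp (-|χ|) * E = (Real.cosh χ - |Real.sinh χ|) * E := by rw [cosh_sub_abs_sinh]
    _ = Real.cosh χ * E - |Real.sinh χ| * E := by ring
    _ ≤ Real.cosh χ * E + Real.sinh χ * p := by linarith

/-- **(L2) Boosted energies cost at most `e^{|χ|}`.** On the cone, `cosh χ·E - sinh χ·p ≤ e^{|χ|} E`; with the
Löwner monotonicity of `t ↦ t^{2ℓ}`, `2ℓ ≤ 1`, this bounds `‖(1+H)^ℓ U_χ w‖ ≤ e^{ℓ|χ|} ‖(1+H)^ℓ w‖` for the
(isometric, by the induction hypothesis) boosts `U_χ` of lower-level vectors. -/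
theorem boosted_energy_le (χ E p : ℝ) (hE : |p| ≤ E) :
    Real.cosh χ * E - Real.sinh χ * p ≤ Real.exp |χ| * E := by
  have h1 : |Real.sinh χ * p| ≤ |Real.sinh χ| * E := by
    rw [abs_mul]; exact mul_le_mul_of_nonneg_left hE (abs_nonneg _)
  have h2 : -(Real.sinh χ * p) ≤ |Real.sinh χ| * E := by linarith [neg_le_abs (Real.sinh χ * p)]
  calc Real.cosh χ * E - Real.sinh χ * p ≤ Real.cosh χ * E + |Real.sinh χ| * E := by linarith
    _ = (Real.cosh χ + |Real.sinh χ|) * E := by ring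
    _ = Real.exp |χ| * E := by rw [cosh_add_abs_sinh]

/-! ## (L3): sub-threshold ray growth kills the negative layers of a finite Laurent sum -/

/-- **(L3)** If `χ ↦ ∑_{|k| ≤ K} p_k e^{-4kχ}` (the doubled pencil of the registered skeleton at `s = e^{-4χ}`, i.e.
`‖V_F(iχ)‖²`) is `O(e^{cχ})` as `χ → +∞` with `c < 8`, then `p_k = 0` for every `k ≤ -2` (the layer `k = -2`
alone would grow like `e^{8χ}`); the mirror statement `χ → -∞` kills `k ≥ 2`.  Pure analysis (dominant term of
a finite exponential sum), difficulty M. -/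
theorem laurent_neg_layers_vanish_of_growth (K : ℕ) (p : ℤ → ℂ) (C c : ℝ) (hc : c < 8)
    (h : ∀ χ : ℝ, 0 ≤ χ →
      ‖∑ k ∈ Finset.Icc (-(K : ℤ)) K, p k * Complex.exp (-(4 * (k : ℂ) * (χ : ℂ)))‖ ≤ C * Real.exp (c * χ)) :
    ∀ k ∈ Finset.Icc (-(K : ℤ)) K, k ≤ -2 → p k = 0 := by
  sorry

/-! ## (S): the stub's smeared shadow over the tree's OS space -/

/-- The unit time vector `e₀`. -/
def e0 : E4 := EuclideanSpace.single 0 1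

/-- Planar slab of scale `s`: Euclidean times in `[s, 2s]`, `|x₁| ≤ s`, transverse coordinates `x₂, x₃` free
(the insertion is localised at planar scale `s` but smeared over an `O(1)` transverse disc — the two
transverse dimensions are where the unit of slack comes from). -/
def planarSlab (s : ℝ) : Set E4 := {x | s ≤ x 0 ∧ x 0 ≤ 2 * s ∧ |x 1| ≤ s}

/-- **(S) TRANSVERSE-SLACK HEAT-SANDWICH BOUND — smeared shadow, exponent `μ`.**  For the `e₀`-reconstruction
`h` of the one-species family `S₁` (tree `OSReconstructionNoE1`: vectors `h.fieldVec`, contraction semigroup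
`h.transfer`, unitary spatial translations `h.translate`): prepending to ANY time-ordered level-`n` test function
`W`, pushed to times `≥ 2s + s'`, one curvature insertion supported in the planar slab of scale `s` (weighted
`L¹`-size `M`, transverse profile of size `O(1)`) multiplies the OS norm by at most `C · M · s^{-μ}`.
The STUB of the line is the sharp form (planar point, transverse Schwartz filter `ȟ(P_⊥)`, operator norm of
`e^{-sH} ȟ(P_⊥) φ̂(0) e^{-s'H}` bounded by `C_h (min s s')^{-μ}`) with `μ < 4`; power counting for `tr F²`
(dimension 4, two transverse dimensions integrated out) gives `μ = 3`; the planar-sharp but transversely SHARP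
insertion has `μ = 4` exactly (the vacuum row `(H+1)^{-2} φ(0) Ω ∉ ℋ` of the parent card). -/
def PlanarSandwichBound (S₁ : SchwingerFamily E4) (h : OSReconstructionNoE1 S₁.toLabelled) (μ C : ℝ) : Prop :=
  ∀ (s s' : ℝ), 0 < s → s ≤ s' → s' ≤ 1 →
  ∀ (F₁ : 𝓢((Fin 1 → E4), ℂ)) (M : ℝ),
    tsupport (F₁ : (Fin 1 → E4) → ℂ) ⊆ {x | x 0 ∈ planarSlab s} →
    (∫ x, ‖F₁ x‖ * (1 + ‖x 0‖) ^ 4 ≤ M) →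
  ∀ (n : ℕ) (W : 𝓢((Fin n → E4), ℂ)) (hW : IsTimeOrdered W)
    (hFW : IsTimeOrdered (SchwartzMap.appendTensor F₁ (translateMulti ((2 * s + s') • e0) W))),
    ‖h.fieldVec (1 + n) (fun _ => ()) (SchwartzMap.appendTensor F₁ (translateMulti ((2 * s + s') • e0) W)) hFW‖
      ≤ C * M * s ^ (-μ) * ‖h.fieldVec n (fun _ => ()) W hW‖

/-! ## (T): the inductive level step the line feeds into the registered skeleton -/

/-- **(T) LEVEL STEP FROM THE SANDWICH (statement shape; proof = the five-line operator chain of the card).**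
Eight frames + cone + a sandwich exponent `μ < 4` + planar invariance in all degrees `≤ 2a - 2` ⇒ every
compactly supported time-ordered level-`a` test function has boosted OS vectors `V_F` on a strip with
`‖V_F(θ)‖ ≤ C e^{μ' |Im θ|}`, `μ' < 4` — hence (L3) no layer `|k| ≥ 2` in its doubled pencil, and the proved
parity sieve closes level `a`. -/
theorem levelStep_of_sandwich (S₁ : SchwingerFamily E4) (h : OSReconstructionNoE1 S₁.toLabelled)
    (μ C : ℝ) (hμ : μ < 4) (hS : PlanarSandwichBound S₁ h μ C)
    (hE0' : S₁.toLabelled.HasLinearGrowth) (hE3 : S₁.toLabelled.IsSymmetric)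
    (h8 : EightFrameRP S₁) (hcone : PlanarCone S₁) (a : ℕ) (ha : 2 ≤ a)
    (hind : ∀ N : ℕ, N + 2 ≤ 2 * a → ∀ R : E4 ≃ₗᵢ[ℝ] E4,
      LinearMap.det (R.toLinearEquiv : E4 →ₗ[ℝ] E4) = 1 →
      R (EuclideanSpace.single 2 1) = EuclideanSpace.single 2 1 →
      R (EuclideanSpace.single 3 1) = EuclideanSpace.single 3 1 →
      ∀ F : 𝓢((Fin N → E4), ℂ), IsOffDiagonal F → S₁ N (linActMulti R F) = S₁ N F)
    (F : 𝓢((Fin a → E4), ℂ)) (hF : IsTimeOrdered F) (hFc : HasCompactSupport (F : (Fin a → E4) → ℂ)) :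
    ∃ (V : ℂ → h.Hilbert) (C' μ' ε : ℝ), μ' < 4 ∧ 0 < ε ∧ DifferentiableOn ℂ V {θ : ℂ | |θ.re| < ε} ∧
      (∀ θ : ℂ, |θ.re| < ε → ‖V θ‖ ≤ C' * Real.exp (μ' * |θ.im|)) ∧
      V 0 = h.fieldVec a (fun _ => ()) F hF := by
  sorry

end Summit.QuantumFields.YangMills.Cruxes.SoftKernelBoostCovariance.TransverseSlackHeatSandwich

end
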